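import Summits.AtomisticToContinuum.HydrodynamicLimit.Theorems.TwoClocksEquilibriumFastWindowLDBirthT12GainDipoleGrowth
import Summits.AtomisticToContinuum.HydrodynamicLimit.Theorems.TwoClocksEquilibriumFastWindowLDBirthT12EnergyAction
import HarnessLib

/-!
# (e-K₂) on the DIPOLE sector, IV: the true gain term on dipole fields `u(x) = ⟪a, x⟫ Θ(‖x‖)` against its
# Lorentz limit in a general weight class — absolute error `O(m ‖a‖ W(‖v‖)(1 + ‖v‖))` — and the lin-log / log
# amplitude classes of the `ℓ = 1` bootstrap (helpers `t12_gainTerm_dipole_sub_lorentz_growth`,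
# `t12_gainTerm_dipole_sub_lorentz_logLinear` of the line `birth`, crux `TwoClocks.EquilibriumFastWindowLD`,
# stmt-AtomisticToContinuum-14440; infrastructure (e-K₂), `ℓ = 1`, towards the registered analytic sub-goal
# `t12_logLinearPreimage_and_dipoleModulus`, plan §5)

Continuation of `…T12GainDipoleGrowth` (slice representation for amplitudes of polynomial growth) and of
`…T12GainDipoleB` (the one-dimensional comparison for BOUNDED amplitudes), in the weight class of
`…T12GainRadialGrowth(B)`: `W : ℝ → ℝ` nondecreasing and `≥ 1` on `[0, ∞)` with the POLYNOMIAL INCREMENT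
`W(s + t) ≤ W(s)(1 + t)ⁿ`, and `Θ` measurable with `|Θ t| ≤ m W(t)` on `[0, ∞)` (bounded: `n = 0`; log `1 + log(1 + t)`:
`n = 1`, `logWeight_class`; lin-log `(1 + t)(1 + log(1 + t))`: `n = 2`, `logLinearWeight_class`). With `S = ‖v‖`, `v = S n`,
`J(t) = ∫_{-1}^{1} (S x - t)₊ (S - (S x - t) x) Θ(√(S² - (S x)² + t²)) dx`, `γ = gaussianReal 0 1`:

* **truncation at the displaced radius** (`abs_dipoleSlice_sub_zero_le_weight`): `J(t)` and `J(0)` only evaluate `Θ`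
  at radii `≤ S + |t|`, where `Θ` coincides with `1_{(-∞, S+|t|]} Θ`, measurable and BOUNDED by `m W(S + |t|)`; so the
  bounded-amplitude comparison `abs_dipoleSlice_sub_zero_le` of `…T12GainDipoleB` — two flux shifts, the radial speed
  shift and the cubic speed shift, no regularity of `Θ` — applies verbatim with `m W(S + |t|)` in place of `m`:
  `|J(t) - J(0)| ≤ m W(S + |t|)((2 + 4S) + 7S|t| + (3 + (3/2)S)t² + S|t|³ + t⁴) ≤ 4 m W(S)(1 + S)(1 + |t|)ⁿ⁺⁴`, the
  displaced radius being brought back to `S` by the polynomial increment against the Gaussian tail of `t`;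
* the registered **`t12_gainTerm_dipole_sub_lorentz_growth`** (`abs_gainTerm_dipole_sub_lorentzGain_le_weight`):
  `|gainTerm u v - lorentzGain u v| ≤ 16π M_{n+4} · m ‖a‖ W(‖v‖)(1 + ‖v‖)`, `M_k = ∫ (1 + |t|)ᵏ dγ` — ABSOLUTE error
  `O(m ‖a‖ W(‖v‖)(1 + ‖v‖))`, RELATIVE error `O(1/‖v‖)` against the main term
  `lorentzGain u (S n) = (4π/S²)⟪a, n⟫∫₀^S r³ Θ(r) dr ≍ m ‖a‖ ‖v‖² W(‖v‖)`, for all classes at once;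
* the two classes of the `ℓ = 1` bootstrap (a-priori the dipole profile of `Π₁ψ₀` has amplitude `≲ C Cg (1 + t)(1 + log(1 + t))`):
  the registered **`t12_gainTerm_dipole_sub_lorentz_logLinear`** — `|Θ t| ≤ m(1 + t)(1 + log(1 + t))` ⟹ error
  `≤ 2816 π m ‖a‖ (1 + ‖v‖)²(1 + log(1 + ‖v‖))` (`16 M_6 ≤ 2816`) — and **`abs_gainTerm_dipole_sub_lorentzGain_le_log`** —
  `|Θ t| ≤ m(1 + log(1 + t))` ⟹ error `≤ 1584 π m ‖a‖ (1 + ‖v‖)(1 + log(1 + ‖v‖))` (`M_5 ≤ (M_4 + M_6)/2 ≤ 99`,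
  `integral_one_add_abs_pow_five_le`). For bounded `Θ` (`n = 0`, `16 M_4 ≤ 352`) the general theorem gives
  `352 π m ‖a‖ (1 + ‖v‖)`, cf. the sharper `2π m ‖a‖ (16 + 29‖v‖)` of `t12_gainTerm_dipole_sub_lorentz`.

[folklore] (Grad 1963 §4; Cercignani–Illner–Pulvirenti 1994 §7.2; (e-K₂) of the corrector-growth plan of the line `birth`).
-/

noncomputable section

open MeasureTheory ProbabilityTheory Real Set Filter Metric
open scoped ENNReal BigOperators InnerProductSpace
namespace Summit.AtomisticToContinuum.HydrodynamicLimit.Theorems.ClampedCorrectorBirth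

open Literature.Analysis.FluidPDE Literature.MathematicalPhysics.KineticTheory
open Literature.Analysis.UnboundedOperators Literature.Probability.Distributions

variable {Θ W : ℝ → ℝ} {m : ℝ} {n : ℕ}

/-! ### The weight class: polynomial growth, truncation at the displaced radius, the slice comparison -/

section WeightClass

variable (hW : (∀ a b : ℝ, 0 ≤ a → a ≤ b → W a ≤ W b) ∧ (∀ a : ℝ, 0 ≤ a → 1 ≤ W a) ∧
    ∀ s t : ℝ, 0 ≤ s → 0 ≤ t → W (s + t) ≤ W s * (1 + t) ^ n)
  (hΘw : ∀ t : ℝ, 0 ≤ t → |Θ t| ≤ m * W t)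
include hW hΘw

/-- **The weight class has polynomial growth**: `|Θ t| ≤ m W(0) (1 + t)ⁿ` on `[0, ∞)` (`W(t) ≤ W(0)(1 + t)ⁿ`), so that
the slice representation of `…T12GainDipoleGrowth` applies. [folklore] -/
theorem polyGrowth_of_weightGrowth (t : ℝ) (ht : 0 ≤ t) : |Θ t| ≤ m * W 0 * (1 + t) ^ n := by
  have hm0 := nonneg_of_weightGrowth hW hΘw
  have h1 : W t ≤ W 0 * (1 + t) ^ n := by simpa using hW.2.2 0 t le_rfl ht
  calc |Θ t| ≤ m * W t := hΘw t ht
    _ ≤ m * (W 0 * (1 + t) ^ n) := mul_le_mul_of_nonneg_left h1 hm0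
    _ = m * W 0 * (1 + t) ^ n := by ring

/-- **Truncation at the displaced radius**: `1_{(-∞, S+|t|]} Θ` is bounded by `m W(S + |t|)` on `[0, ∞)` (`0 ≤ S`;
`W` nondecreasing, `m ≥ 0`, `W ≥ 1`). [folklore] -/
theorem abs_truncate_le_weight {S : ℝ} (hS : 0 ≤ S) (t r : ℝ) (hr : 0 ≤ r) :
    |(Iic (S + |t|)).indicator Θ r| ≤ m * W (S + |t|) := by
  have hm0 := nonneg_of_weightGrowth hW hΘw
  by_cases h : r ∈ Iic (S + |t|)
  · rw [indicator_of_mem h]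
    exact (hΘw r hr).trans (mul_le_mul_of_nonneg_left (hW.1 _ _ hr h) hm0)
  · rw [indicator_of_notMem h, abs_zero]
    exact mul_nonneg hm0 (zero_le_one.trans (hW.2.1 _ (by positivity)))

/-- **The dipole slice comparison, pointwise in the thermal projection**, in the weight class: for `0 ≤ S` and every
`t`, with `J(t) = ∫_{-1}^{1} (S x - t)₊ (S - (S x - t) x) Θ(√(S² - (S x)² + t²)) dx`,
`|J(t) - J(0)| ≤ m W(S + |t|) ((2 + 4S) + 7S|t| + (3 + (3/2)S)t² + S|t|³ + t⁴) ≤ 4 m W(S)(1 + S)(1 + |t|)ⁿ⁺⁴`: both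
slices only see radii `≤ S + |t|` (`sqrt_sq_sub_sq_add_sq_le`), where `Θ` is its truncation, bounded by `m W(S + |t|)`,
so the bounded-amplitude comparison `abs_dipoleSlice_sub_zero_le` (two flux shifts, radial and cubic speed shifts)
applies verbatim; then `(2 + 4S) + 7Su + (3 + (3/2)S)u² + Su³ + u⁴ ≤ 4(1 + S)(1 + u)⁴` and the polynomial increment
`W(S + |t|) ≤ W(S)(1 + |t|)ⁿ`. [folklore] -/
theorem abs_dipoleSlice_sub_zero_le_weight (hΘ : Measurable Θ) {S : ℝ} (hS : 0 ≤ S) (t : ℝ) :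
    |(∫ x in (-1:ℝ)..1, max (S * x - t) 0 * (S - (S * x - t) * x) * Θ (√(S ^ 2 - (S * x) ^ 2 + t ^ 2))) -
        ∫ x in (-1:ℝ)..1, max (S * x) 0 * (S - S * x * x) * Θ (√(S ^ 2 - (S * x) ^ 2))| ≤
      m * W (S + |t|) * ((2 + 4 * S) + 7 * S * |t| + (3 + 3 / 2 * S) * t ^ 2 + S * |t| ^ 3 + t ^ 4) ∧
    m * W (S + |t|) * ((2 + 4 * S) + 7 * S * |t| + (3 + 3 / 2 * S) * t ^ 2 + S * |t| ^ 3 + t ^ 4) ≤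
      4 * m * W S * (1 + S) * (1 + |t|) ^ (n + 4) := by
  have hm0 := nonneg_of_weightGrowth hW hΘw
  have key1 : ∀ b : ℝ, (Iic (S + |t|)).indicator Θ (√(S ^ 2 - b ^ 2 + t ^ 2)) = Θ (√(S ^ 2 - b ^ 2 + t ^ 2)) :=
    fun b => indicator_of_mem (show √(S ^ 2 - b ^ 2 + t ^ 2) ∈ Iic (S + |t|) from sqrt_sq_sub_sq_add_sq_le hS b t) Θ
  have key0 : ∀ b : ℝ, (Iic (S + |t|)).indicator Θ (√(S ^ 2 - b ^ 2)) = Θ (√(S ^ 2 - b ^ 2)) := fun b => by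
    refine indicator_of_mem (show √(S ^ 2 - b ^ 2) ∈ Iic (S + |t|) from ?_) Θ
    have h := sqrt_sq_sub_sq_add_sq_le hS b 0
    simp only [ne_eq, OfNat.ofNat_ne_zero, not_false_eq_true, zero_pow, add_zero, abs_zero] at h
    exact h.trans (le_add_of_nonneg_right (abs_nonneg t))
  have h := abs_dipoleSlice_sub_zero_le (hΘ.indicator measurableSet_Iic) (abs_truncate_le_weight hW hΘw hS t) hS t
  simp_rw [key1, key0] at h
  refine ⟨h, ?_⟩
  have hWt : W (S + |t|) ≤ W S * (1 + |t|) ^ n := hW.2.2 S |t| hS (abs_nonneg t)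
  have hW0 : 0 ≤ W S := zero_le_one.trans (hW.2.1 S hS)
  have henv : (2 + 4 * S) + 7 * S * |t| + (3 + 3 / 2 * S) * t ^ 2 + S * |t| ^ 3 + t ^ 4 ≤
      4 * (1 + S) * (1 + |t|) ^ 4 := by
    have h2 : t ^ 2 = |t| ^ 2 := (sq_abs t).symm
    have h4 : t ^ 4 = |t| ^ 4 := by rw [show t ^ 4 = (t ^ 2) ^ 2 by ring, h2]; ring
    rw [h2, h4]
    nlinarith [abs_nonneg t, mul_nonneg hS (abs_nonneg t), pow_nonneg (abs_nonneg t) 2,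
      mul_nonneg hS (pow_nonneg (abs_nonneg t) 2), pow_nonneg (abs_nonneg t) 3,
      mul_nonneg hS (pow_nonneg (abs_nonneg t) 3), pow_nonneg (abs_nonneg t) 4,
      mul_nonneg hS (pow_nonneg (abs_nonneg t) 4)]
  have henv0 : 0 ≤ (2 + 4 * S) + 7 * S * |t| + (3 + 3 / 2 * S) * t ^ 2 + S * |t| ^ 3 + t ^ 4 := by positivity
  calc m * W (S + |t|) * ((2 + 4 * S) + 7 * S * |t| + (3 + 3 / 2 * S) * t ^ 2 + S * |t| ^ 3 + t ^ 4)
      ≤ m * (W S * (1 + |t|) ^ n) * (4 * (1 + S) * (1 + |t|) ^ 4) :=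
        mul_le_mul (mul_le_mul_of_nonneg_left hWt hm0) henv henv0 (by positivity)
    _ = 4 * m * W S * (1 + S) * (1 + |t|) ^ (n + 4) := by ring

/-- **(e-K₂) on dipole fields of the weight class**: for `a ∈ ℝ³`, `Θ : ℝ → ℝ` measurable with `|Θ t| ≤ m W(t)` on
`[0, ∞)`, `W ≥ 1` nondecreasing with `W(s + t) ≤ W(s)(1 + t)ⁿ`, `u = ⟪a, ·⟫ Θ(‖·‖)` and every `v ∈ ℝ³`,
`|gainTerm u v - lorentzGain u v| ≤ 16π m ‖a‖ W(‖v‖) (1 + ‖v‖) ∫ (1 + |t|)ⁿ⁺⁴ dγ(t)` — the slice form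
`4π⟪a, n⟫ ∫ γ(dt) (J(t) - J(0))` (`gainTerm_sub_lorentzGain_dipole_eq_poly`, the class having polynomial growth),
`|⟪a, n⟫| ≤ ‖a‖` and the pointwise slice comparison. [folklore] -/
theorem abs_gainTerm_dipole_sub_lorentzGain_le_weight (hΘ : Measurable Θ) (a v : EuclideanSpace ℝ (Fin 3)) :
    |gainTerm (fun x => ⟪a, x⟫_ℝ * Θ ‖x‖) v - lorentzGain (fun x => ⟪a, x⟫_ℝ * Θ ‖x‖) v| ≤
      16 * π * m * ‖a‖ * W ‖v‖ * (1 + ‖v‖) * ∫ t, (1 + |t|) ^ (n + 4) ∂gaussianReal 0 1 := by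
  have hm0 := nonneg_of_weightGrowth hW hΘw
  have hW0 : 0 ≤ W ‖v‖ := zero_le_one.trans (hW.2.1 _ (norm_nonneg v))
  obtain ⟨e, he, hve⟩ := exists_unit_inner_eq v
  have hae : |⟪a, e⟫_ℝ| ≤ ‖a‖ := by
    have h := abs_real_inner_le_norm a e
    rwa [he, mul_one] at h
  have hg : Integrable (fun t : ℝ => 4 * m * W ‖v‖ * (1 + ‖v‖) * (1 + |t|) ^ (n + 4)) (gaussianReal 0 1) :=
    (EnskogAdjointDuality.k2r_ref_integrable_one_add_abs_pow (n + 4)).const_mul _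
  have hpt : ∀ t, |(∫ x in (-1:ℝ)..1,
      max (‖v‖ * x - t) 0 * (‖v‖ - (‖v‖ * x - t) * x) * Θ (√(‖v‖ ^ 2 - (‖v‖ * x) ^ 2 + t ^ 2))) -
        ∫ x in (-1:ℝ)..1, max (‖v‖ * x) 0 * (‖v‖ - ‖v‖ * x * x) * Θ (√(‖v‖ ^ 2 - (‖v‖ * x) ^ 2))| ≤
      4 * m * W ‖v‖ * (1 + ‖v‖) * (1 + |t|) ^ (n + 4) := fun t =>
    (abs_dipoleSlice_sub_zero_le_weight hW hΘw hΘ (norm_nonneg v) t).1.trans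
      (abs_dipoleSlice_sub_zero_le_weight hW hΘw hΘ (norm_nonneg v) t).2
  rw [gainTerm_sub_lorentzGain_dipole_eq_poly a hΘ (polyGrowth_of_weightGrowth hW hΘw) he hve, abs_mul, abs_mul,
    abs_of_pos (by positivity : (0:ℝ) < 4 * π)]
  calc 4 * π * |⟪a, e⟫_ℝ| * |∫ t, ((∫ x in (-1:ℝ)..1,
          max (‖v‖ * x - t) 0 * (‖v‖ - (‖v‖ * x - t) * x) * Θ (√(‖v‖ ^ 2 - (‖v‖ * x) ^ 2 + t ^ 2))) -
        ∫ x in (-1:ℝ)..1, max (‖v‖ * x) 0 * (‖v‖ - ‖v‖ * x * x) * Θ (√(‖v‖ ^ 2 - (‖v‖ * x) ^ 2))) ∂gaussianReal 0 1|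
      ≤ 4 * π * ‖a‖ * ∫ t, 4 * m * W ‖v‖ * (1 + ‖v‖) * (1 + |t|) ^ (n + 4) ∂gaussianReal 0 1 := by
        refine mul_le_mul (by gcongr) ?_ (abs_nonneg _) (by positivity)
        rw [← Real.norm_eq_abs]
        exact norm_integral_le_of_norm_le hg (Eventually.of_forall fun t => by rw [Real.norm_eq_abs]; exact hpt t)
    _ = 16 * π * m * ‖a‖ * W ‖v‖ * (1 + ‖v‖) * ∫ t, (1 + |t|) ^ (n + 4) ∂gaussianReal 0 1 := by
        rw [integral_const_mul]; ring

end WeightClass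

/-! ### The two amplitude classes of the `ℓ = 1` bootstrap -/

/-- **The log weight** `W(t) = 1 + log(1 + t)` is in the class with `n = 1`: nondecreasing and `≥ 1` on `[0, ∞)`, and
`W(s + t) ≤ W(s)(1 + t)` (`log(1 + s + t) ≤ log(1 + s) + log(1 + t)`, `log(1 + t) ≤ t ≤ t W(s)`). [folklore] -/
theorem logWeight_class :
    (∀ a b : ℝ, 0 ≤ a → a ≤ b → 1 + Real.log (1 + a) ≤ 1 + Real.log (1 + b)) ∧
      (∀ a : ℝ, 0 ≤ a → 1 ≤ 1 + Real.log (1 + a)) ∧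
      ∀ s t : ℝ, 0 ≤ s → 0 ≤ t → 1 + Real.log (1 + (s + t)) ≤ (1 + Real.log (1 + s)) * (1 + t) ^ 1 := by
  have hlog0 : ∀ a : ℝ, 0 ≤ a → 0 ≤ Real.log (1 + a) := fun a ha => Real.log_nonneg (by linarith)
  refine ⟨fun a b ha hab => ?_, fun a ha => ?_, fun s t hs ht => ?_⟩
  · linarith [Real.log_le_log (by linarith) (by linarith : 1 + a ≤ 1 + b)]
  · linarith [hlog0 a ha]
  · have h1 : 1 + (s + t) ≤ (1 + s) * (1 + t) := by nlinarith
    have h2 : Real.log (1 + (s + t)) ≤ Real.log (1 + s) + t := by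
      calc Real.log (1 + (s + t)) ≤ Real.log ((1 + s) * (1 + t)) := Real.log_le_log (by linarith) h1
        _ = Real.log (1 + s) + Real.log (1 + t) := Real.log_mul (by linarith) (by linarith)
        _ ≤ Real.log (1 + s) + t := by linarith [Real.log_le_sub_one_of_pos (by linarith : (0:ℝ) < 1 + t)]
    rw [pow_one]
    nlinarith [hlog0 s hs, mul_nonneg (hlog0 s hs) ht]

/-- **The fifth absolute Gaussian moment**: `M_5 = ∫ (1 + |t|)⁵ dγ ≤ 99` (`2(1 + u)⁵ ≤ (1 + u)⁴ + (1 + u)⁶`, the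
difference being `u²(1 + u)⁴`, and `M_4 ≤ 22`, `M_6 ≤ 176`, `integral_one_add_abs_pow_le`). [folklore] -/
theorem integral_one_add_abs_pow_five_le : ∫ t, (1 + |t|) ^ 5 ∂gaussianReal 0 1 ≤ 99 := by
  obtain ⟨h4, h6⟩ := integral_one_add_abs_pow_le
  have i4 := EnskogAdjointDuality.k2r_ref_integrable_one_add_abs_pow 4
  have i6 := EnskogAdjointDuality.k2r_ref_integrable_one_add_abs_pow 6
  calc ∫ t, (1 + |t|) ^ 5 ∂gaussianReal 0 1 ≤ ∫ t, ((1 + |t|) ^ 4 + (1 + |t|) ^ 6) / 2 ∂gaussianReal 0 1 := by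
        refine integral_mono (EnskogAdjointDuality.k2r_ref_integrable_one_add_abs_pow 5) ((i4.add i6).div_const 2)
          fun t => ?_
        dsimp only
        nlinarith [mul_nonneg (sq_nonneg |t|) (pow_nonneg (by positivity : (0:ℝ) ≤ 1 + |t|) 4)]
    _ = ((∫ t, (1 + |t|) ^ 4 ∂gaussianReal 0 1) + ∫ t, (1 + |t|) ^ 6 ∂gaussianReal 0 1) / 2 := by
        rw [integral_div, integral_add i4 i6]
    _ ≤ 99 := by linarith

/-- **(e-K₂) on dipole fields in the log class** (second round of the `ℓ = 1` bootstrap): for `Θ` measurable with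
`|Θ t| ≤ m (1 + log(1 + t))` on `[0, ∞)`, `u = ⟪a, ·⟫ Θ(‖·‖)` and every `v`,
`|gainTerm u v - lorentzGain u v| ≤ 1584 π m ‖a‖ (1 + ‖v‖)(1 + log(1 + ‖v‖))` (the general theorem with `n = 1`,
`logWeight_class`, and `16 M_5 ≤ 1584`) — relative `O(1/‖v‖)` against the main term `≍ m ‖a‖ ‖v‖² log ‖v‖`. [folklore] -/
theorem abs_gainTerm_dipole_sub_lorentzGain_le_log (a : EuclideanSpace ℝ (Fin 3)) (hΘ : Measurable Θ)
    (hΘw : ∀ t : ℝ, 0 ≤ t → |Θ t| ≤ m * (1 + Real.log (1 + t))) (v : EuclideanSpace ℝ (Fin 3)) :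
    |gainTerm (fun x => ⟪a, x⟫_ℝ * Θ ‖x‖) v - lorentzGain (fun x => ⟪a, x⟫_ℝ * Θ ‖x‖) v| ≤
      1584 * π * m * ‖a‖ * (1 + ‖v‖) * (1 + Real.log (1 + ‖v‖)) := by
  have hW := logWeight_class
  have h := abs_gainTerm_dipole_sub_lorentzGain_le_weight (W := fun t => 1 + Real.log (1 + t)) hW hΘw hΘ a v
  have hm0 := nonneg_of_weightGrowth (W := fun t => 1 + Real.log (1 + t)) hW hΘw
  have hW0 : 0 ≤ 1 + Real.log (1 + ‖v‖) := zero_le_one.trans (hW.2.1 _ (norm_nonneg v))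
  refine h.trans ?_
  calc 16 * π * m * ‖a‖ * (1 + Real.log (1 + ‖v‖)) * (1 + ‖v‖) * ∫ t, (1 + |t|) ^ (1 + 4) ∂gaussianReal 0 1
      ≤ 16 * π * m * ‖a‖ * (1 + Real.log (1 + ‖v‖)) * (1 + ‖v‖) * 99 :=
        mul_le_mul_of_nonneg_left integral_one_add_abs_pow_five_le (by positivity)
    _ = 1584 * π * m * ‖a‖ * (1 + ‖v‖) * (1 + Real.log (1 + ‖v‖)) := by ring

/-- **(e-K₂) on dipole fields in the lin-log class** (first round of the `ℓ = 1` bootstrap): for `Θ` measurable with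
`|Θ t| ≤ m (1 + t)(1 + log(1 + t))` on `[0, ∞)`, `u = ⟪a, ·⟫ Θ(‖·‖)` and every `v`,
`|gainTerm u v - lorentzGain u v| ≤ 2816 π m ‖a‖ (1 + ‖v‖)²(1 + log(1 + ‖v‖))` (the general theorem with `n = 2`,
`logLinearWeight_class`, and `16 M_6 ≤ 2816`) — relative `O(1/‖v‖)` against the main term `≍ m ‖a‖ ‖v‖³ log ‖v‖`. [folklore] -/
theorem abs_gainTerm_dipole_sub_lorentzGain_le_logLinear (a : EuclideanSpace ℝ (Fin 3)) (hΘ : Measurable Θ)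
    (hΘw : ∀ t : ℝ, 0 ≤ t → |Θ t| ≤ m * (1 + t) * (1 + Real.log (1 + t))) (v : EuclideanSpace ℝ (Fin 3)) :
    |gainTerm (fun x => ⟪a, x⟫_ℝ * Θ ‖x‖) v - lorentzGain (fun x => ⟪a, x⟫_ℝ * Θ ‖x‖) v| ≤
      2816 * π * m * ‖a‖ * (1 + ‖v‖) ^ 2 * (1 + Real.log (1 + ‖v‖)) := by
  have hW := logLinearWeight_class
  have hΘw' : ∀ t : ℝ, 0 ≤ t → |Θ t| ≤ m * ((1 + t) * (1 + Real.log (1 + t))) :=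
    fun t ht => (hΘw t ht).trans_eq (by ring)
  have h := abs_gainTerm_dipole_sub_lorentzGain_le_weight (W := fun t => (1 + t) * (1 + Real.log (1 + t)))
    hW hΘw' hΘ a v
  have hm0 := nonneg_of_weightGrowth (W := fun t => (1 + t) * (1 + Real.log (1 + t))) hW hΘw'
  have hlog : 0 ≤ Real.log (1 + ‖v‖) := Real.log_nonneg (by linarith [norm_nonneg v])
  refine h.trans ?_
  calc 16 * π * m * ‖a‖ * ((1 + ‖v‖) * (1 + Real.log (1 + ‖v‖))) * (1 + ‖v‖) *
        ∫ t, (1 + |t|) ^ (2 + 4) ∂gaussianReal 0 1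
      ≤ 16 * π * m * ‖a‖ * ((1 + ‖v‖) * (1 + Real.log (1 + ‖v‖))) * (1 + ‖v‖) * 176 :=
        mul_le_mul_of_nonneg_left integral_one_add_abs_pow_le.2 (by positivity)
    _ = 2816 * π * m * ‖a‖ * (1 + ‖v‖) ^ 2 * (1 + Real.log (1 + ‖v‖)) := by ring

/-! ### Registered helpers -/

/-- **Registered helper `t12_gainTerm_dipole_sub_lorentz_growth` — (e-K₂) on the DIPOLE sector for amplitudes of
HIGHER GROWTH: the true gain term of the linearised hard-sphere operator on a dipole field `u(x) = ⟪a, x⟫ Θ(‖x‖)`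
against its far-field (Lorentz) limit, for `Θ` merely measurable and dominated by a weight of the
polynomial-increment class.** Data: `W : ℝ → ℝ` nondecreasing on `[0, ∞)` with `W ≥ 1` there and
`W(s + t) ≤ W(s)(1 + t)ⁿ` (`s, t ≥ 0`; e.g. `1` (`n = 0`), `1 + log(1 + t)` (`n = 1`, `logWeight_class`),
`(1 + t)(1 + log(1 + t))` (`n = 2`, `logLinearWeight_class`), `(1 + t)ᵏ` (`n = k`)); `Θ : ℝ → ℝ` measurable with
`|Θ t| ≤ m W(t)` for `t ≥ 0` (no continuity, no bounded variation); `a ∈ ℝ³`. Then for every `v ∈ ℝ³`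
(`M = stdGaussian`, `σ` the surface measure of `S²`, `(v', w') = collide ω (v, w)`, `γ = gaussianReal 0 1`,
`lorentzGain` the partner-at-rest operator of `…T12Lorentz`):
`|∫ dM(w) ∫_{S²} ((v-w)·ω)₊ u(v') dσ + ∫ dM(w) ∫_{S²} ((v-w)·ω)₊ u(w') dσ - lorentzGain u v| ≤ 16π m ‖a‖ W(‖v‖)(1 + ‖v‖) ∫ (1 + |t|)ⁿ⁺⁴ dγ(t)`,
i.e. `|gainTerm u v - lorentzGain u v| ≤ 16π M_{n+4} · m ‖a‖ W(‖v‖)(1 + ‖v‖)`, `M_k = ∫ (1 + |t|)ᵏ dγ` (`M_4 ≤ 22`,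
`M_5 ≤ 99`, `M_6 ≤ 176`) — ABSOLUTE error `O(m ‖a‖ W(‖v‖)(1 + ‖v‖))`, RELATIVE error `O(1/‖v‖)` against the main term
`lorentzGain u (S n) = (4π/S²)⟪a, n⟫∫₀^S r³ Θ(r) dr ≍ m ‖a‖ ‖v‖² W(‖v‖)`: the order each round of the `ℓ = 1` bootstrap
consumes. Mechanism: the slice form `gainTerm u v - lorentzGain u v = 4π⟪a, n⟫ ∫ γ(dt)(J(t) - J(0))`,
`J(t) = ∫_{-1}^{1} (Sx - t)₊ (S - (Sx - t)x) Θ(√(S² - (Sx)² + t²)) dx`, `S = ‖v‖`, `v = S n`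
(`t12_gainTerm_dipole_slice_growth`, the class having polynomial growth); `J(t)`, `J(0)` see only radii `≤ S + |t|`,
where `Θ` is its truncation, BOUNDED by `m W(S + |t|)`, so the bounded comparison of `t12_gainTerm_dipole_sub_lorentz`
(two flux shifts, the radial speed shift `y = S² - (Sx)² + t²`, the cubic speed shift) gives
`|J(t) - J(0)| ≤ m W(S + |t|)((2 + 4S) + 7S|t| + (3 + (3/2)S)t² + S|t|³ + t⁴) ≤ 4 m W(S)(1 + S)(1 + |t|)ⁿ⁺⁴`, the
displaced radius `S + |t|` being brought back to `S` by the polynomial increment against the Gaussian tail of `t`;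
and `|⟪a, n⟫| ≤ ‖a‖`. [folklore] -/
theorem t12_gainTerm_dipole_sub_lorentz_growth : ∀ (a : EuclideanSpace ℝ (Fin 3)) (Θ W : ℝ → ℝ) (m : ℝ) (n : ℕ), Measurable Θ → (∀ r s : ℝ, 0 ≤ r → r ≤ s → W r ≤ W s) → (∀ r : ℝ, 0 ≤ r → 1 ≤ W r) → (∀ s t : ℝ, 0 ≤ s → 0 ≤ t → W (s + t) ≤ W s * (1 + t) ^ n) → (∀ t : ℝ, 0 ≤ t → |Θ t| ≤ m * W t) → ∀ v : EuclideanSpace ℝ (Fin 3), |Summit.AtomisticToContinuum.HydrodynamicLimit.Theorems.ClampedCorrectorBirth.gainTerm (fun x : EuclideanSpace ℝ (Fin 3) => inner ℝ a x * Θ ‖x‖) v - Summit.AtomisticToContinuum.HydrodynamicLimit.Theorems.ClampedCorrectorBirth.lorentzGain (fun x : EuclideanSpace ℝ (Fin 3) => inner ℝ a x * Θ ‖x‖) v| ≤ 16 * Real.pi * m * ‖a‖ * W ‖v‖ * (1 + ‖v‖) * ∫ t, (1 + |t|) ^ (n + 4) ∂ProbabilityTheory.gaussianReal 0 1 :=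
  fun a _ _ _ _ hΘ hmono hone hsub hΘw v => abs_gainTerm_dipole_sub_lorentzGain_le_weight ⟨hmono, hone, hsub⟩ hΘw hΘ a v

/-- **Registered helper `t12_gainTerm_dipole_sub_lorentz_logLinear` — (e-K₂) on the DIPOLE sector in the lin-log
amplitude class, the first round of the `ℓ = 1` bootstrap** (a-priori the dipole profile of `Π₁ψ₀` has amplitude
`≲ C Cg (1 + t)(1 + log(1 + t))`). For `a ∈ ℝ³`, `Θ : ℝ → ℝ` measurable with `|Θ t| ≤ m (1 + t)(1 + log(1 + t))` for
`t ≥ 0`, `u(x) = ⟪a, x⟫ Θ(‖x‖)` and every `v ∈ ℝ³` (notation as in `t12_gainTerm_dipole_sub_lorentz_growth`):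
`|∫ dM(w) ∫_{S²} ((v-w)·ω)₊ u(v') dσ + ∫ dM(w) ∫_{S²} ((v-w)·ω)₊ u(w') dσ - lorentzGain u v| ≤ 2816 π m ‖a‖ (1 + ‖v‖)² (1 + log(1 + ‖v‖))`,
i.e. `|gainTerm u v - lorentzGain u v| ≤ 2816 π m ‖a‖ (1 + ‖v‖) W(‖v‖)`, `W(t) = (1 + t)(1 + log(1 + t))` — the general
theorem with `n = 2` (`logLinearWeight_class`) and `16 M_6 ≤ 2816`; relative `O(1/‖v‖)` against the main term
`≍ m ‖a‖ ‖v‖³ log ‖v‖`. The log class (second round, `n = 1`, constant `1584 π`) is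
`abs_gainTerm_dipole_sub_lorentzGain_le_log`. [folklore] -/
theorem t12_gainTerm_dipole_sub_lorentz_logLinear : ∀ (a : EuclideanSpace ℝ (Fin 3)) (Θ : ℝ → ℝ) (m : ℝ), Measurable Θ → (∀ t : ℝ, 0 ≤ t → |Θ t| ≤ m * (1 + t) * (1 + Real.log (1 + t))) → ∀ v : EuclideanSpace ℝ (Fin 3), |Summit.AtomisticToContinuum.HydrodynamicLimit.Theorems.ClampedCorrectorBirth.gainTerm (fun x : EuclideanSpace ℝ (Fin 3) => inner ℝ a x * Θ ‖x‖) v - Summit.AtomisticToContinuum.HydrodynamicLimit.Theorems.ClampedCorrectorBirth.lorentzGain (fun x : EuclideanSpace ℝ (Fin 3) => inner ℝ a x * Θ ‖x‖) v| ≤ 2816 * Real.pi * m * ‖a‖ * (1 + ‖v‖) ^ 2 * (1 + Real.log (1 + ‖v‖)) :=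
  fun a _ _ hΘ hΘw v => abs_gainTerm_dipole_sub_lorentzGain_le_logLinear a hΘ hΘw v

end Summit.AtomisticToContinuum.HydrodynamicLimit.Theorems.ClampedCorrectorBirth

end
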